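import Literature.NumberTheory.LFunctions.WeilTwoPrimeCertificateDeflatedOK
import Literature.NumberTheory.LFunctions.WeilTwoPrimeCertificateDeflatedSector
import HarnessLib

/-!
# The deflated two-prime certificate from a valid cell chain: the EVEN-sector form

Topic `Literature/NumberTheory/LFunctions`; companion of `WeilTwoPrimeCertificateDeflatedOK.lean` (`WeilCert23.checkROK` /
`checkR1OK`: the rank-one augmented Yoshida moment certificate without the cell check, both blocks / odd block, and their
soundness from the semantic chain hypothesis `CellsOK₂₃`) and of `WeilTwoPrimeCertificateDeflatedSector.lean` (the
generic one-block algebraic core `WeilCert.core_nonnegR_block`).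

* `WeilCert23.checkR0OK` / **`WeilCert23.weilTwoPrimeQuadratic_rankOne_bound_even_of_cellsOK`** — the EVEN-SECTOR form:
  only the even block of `P_r + Σ μ ĉ ĉᵀ` is checked and the conclusion is stated for even tests (`g(−x) = g(x)`), whose
  odd moments vanish (`weilMoment_odd_of_even`), so the odd block contributes nothing (`WeilCert.core_nonnegR_block`
  with `p = 0`).  This is the complement certificate `hcert` of the deflated Temple L-side for the EVEN sector
  (`dt_weilEvenGroundEnergy_ge_of_ritz`), i.e. the positivity-grade block of the window `[-a₀, a₀]`.

All proved; no named facts.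

## References
* H. Yoshida, *On Hermitian forms attached to zeta functions*, Adv. Stud. Pure Math. 21 (1992), §2, §6, Thm 1. [Yoshida1992]
* A. Weinstein, W. Stenger, *Methods of Intermediate Problems for Eigenvalues* (1972), Ch. 5 §9. [WeinsteinStenger1972]
-/

noncomputable section

open Complex Finset MeasureTheory Set Filter
open scoped Real Topology ComplexConjugate BigOperators

namespace Literature.NumberTheory.LFunctions

open Literature.Analysis.ValidatedNumerics.Numerics
open Literature.Analysis.SpecialFunctions

namespace WeilCert23

variable (c : WeilCert23)

/-- **The EVEN-SECTOR rank-one augmented checker without the cell check**: scalars, moment table, `β ≤ κ`, and the EVEN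
parity block only (Yoshida's moment-certificate format, rank-one augmented). [folklore] -/
def checkR0OK (β : ℚ) (R : List (ℚ × ℕ × List ℚ)) : Bool :=
  c.checkScalars && c.checkNu && decide (β ≤ c.kappaQ) &&
    c.base.checkBlockP (fun k l ↦ c.base.prQ c.nuTab k l + rankOneQ R k l) (c.kappaQ - β) 0

variable {c}

/-- Unpacking `checkR0OK` (private plumbing). [folklore] -/
private theorem checkR0OK_spec {β : ℚ} {R : List (ℚ × ℕ × List ℚ)} (h : c.checkR0OK β R = true) :
    c.checkScalars = true ∧ c.checkNu = true ∧ β ≤ c.kappaQ ∧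
      c.base.checkBlockP (fun k l ↦ c.base.prQ c.nuTab k l + rankOneQ R k l) (c.kappaQ - β) 0 = true := by
  unfold checkR0OK at h
  simp only [Bool.and_eq_true, decide_eq_true_eq] at h
  exact ⟨h.1.1.1, h.1.1.2, h.1.2, h.2⟩

/-- **Soundness of the EVEN-SECTOR rank-one augmented two-prime certificate from a valid chain.** If the chain is valid
(`CellsOK₂₃`) and `c.checkR0OK β R = true` (even block only) then for every EVEN test function `g` supported in `[-b, b]`:
`β ‖g‖₂² ≤ E₂₃(g) + Σ_{(μ,q,c) ∈ R} μ |Σ_{k ≤ N} ĉ_k M_k(g)|²`, `M_k(g) = ∫ g(x)(x/a₀)^k dx` — the odd moments of an even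
test vanish, so the odd block is not needed.  This is the complement certificate `hcert` of the deflated Temple L-side
for the even sector, with polynomial trial vectors `v_i = Σ_k ĉ_{ik}(x/a₀)^k` on the window.
[cite: Yoshida1992, §6, Thm 1 p. 310 (moment certificates)] -/
theorem weilTwoPrimeQuadratic_rankOne_bound_even_of_cellsOK {β : ℚ} {R : List (ℚ × ℕ × List ℚ)}
    (hcells : CellsOK₂₃ c.base.wL c.base.T c.cells) (h : c.checkR0OK β R = true)
    {g : ℝ → ℂ} (hg : IsWeilTest g) (hsupp : tsupport g ⊆ Icc (-(c.b : ℝ)) c.b) (heven : ∀ x, g (-x) = g x) :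
    (β : ℝ) * weilNorm2Sq g ≤ weilTwoPrimeQuadratic g +
      (R.map fun r ↦ (r.1 : ℝ) * ‖∑ k ∈ range (c.base.N + 1),
        ((maskV r k : ℚ) : ℂ) * weilMoment c.base.a0 g k‖ ^ 2).sum := by
  obtain ⟨hsc, hnuchk, hβ, hb0⟩ := checkR0OK_spec h
  obtain ⟨-, hbpos, hba, -, -, -, -, hN, -⟩ := scalars_spec hsc
  have hb0' : (0 : ℝ) < c.b := by exact_mod_cast hbpos
  have hba' : ((c.b : ℚ) : ℝ) ≤ (c.base.a0 : ℝ) := by exact_mod_cast hba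
  have ha : (0 : ℝ) < (c.base.a0 : ℝ) := by linarith
  have hsupp' : tsupport g ⊆ Icc (-(c.base.a0 : ℝ)) c.base.a0 := hsupp.trans (Icc_subset_Icc (by linarith) hba')
  have step3 := margin_step3_of_cellsOK hcells hsc hnuchk hg hsupp
  have hbes := weilNorm2Sq_ge_bessel hg ha hsupp' (c.base.N + 1) (c.base.uVec (weilMoment c.base.a0 g))
  have hM : ∀ i, weilMoment c.base.a0 g (2 * i + (1 - 0)) = 0 := fun i ↦
    weilMoment_odd_of_even heven _ ⟨i, by ring⟩
  have hcore := WeilCert.core_nonnegR_block (c := c.base) (nu := c.nuTab) (κ := c.kappaQ - β) R hN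
    (p := 0) (by norm_num) hb0 (weilMoment c.base.a0 g) hM
  have hκ' : (0 : ℝ) ≤ ((c.kappaQ - β : ℚ) : ℝ) := by exact_mod_cast sub_nonneg.2 hβ
  have h4 := mul_le_mul_of_nonneg_left hbes hκ'
  push_cast at hcore h4 ⊢
  nlinarith [step3, hcore, h4]

end WeilCert23

end Literature.NumberTheory.LFunctions

end
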